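import Literature.Analysis.FluidPDE.OnsagerBDSVGluing
import Literature.Analysis.FluidPDE.OnsagerBDSVParameters
import Literature.Analysis.FunctionSpaces.HolderInterpolation
import Mathlib.Analysis.Calculus.Deriv.Shift
import HarnessLib

/-!
# The BDSV gluing stage assembled from its printed ingredients (proof)

`BDSV.gluingStage` (`OnsagerBDSVThreeStages.lean`; Buckmaster–De Lellis–Székelyhidi–Vicol 2019,
§2.5 with (2.17)–(2.22)) follows from the three named facts of `OnsagerBDSVGluing.lean` —
Prop. 3.1 (`BDSV.localEulerHolder`), §3 (`BDSV.gluingStability`) and §4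
(`BDSV.gluedTripleEstimates`) — by the half page of §3.1 that defines the exact solutions `vᵢ`:

* the CFL condition of §2.5, `τ_q ‖v_ℓ‖_{1+α} ≲ τ_q δ_q^{1/2} λ_q ℓ^{-α} ≲ ℓ^α ≪ 1`: from (2.13)
  with `N = 0, 1` and the interpolation `[Df]_α ≤ ‖D²f‖_∞ ℓ^{1-α} + 2‖Df‖_∞ ℓ^{-α}`
  (`eContDiffHolderNorm_le_of_norm_iteratedFDeriv_le`) one gets
  `‖v_ℓ(t)‖_{1+α} ≤ (4|C₀| + |C₁|) δ_q^{1/2} λ_q ℓ^{-α}`, hence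
  `τ_q ‖v_ℓ(t)‖_{1+α} ≤ (4|C₀| + |C₁|) ℓ^α ≤ (4|C₀| + |C₁|) λ_q^{-α} ≤ c(α)` for `a` large
  (`BDSV.eContDiffHolderNorm_one_le_of_holderSupLE`, `BDSV.glueScale_mul_cflBound`);
* Prop. 3.1 then provides, for every anchor `tᵢ = iτ_q ≤ T`, an exact solution on
  `[tᵢ - τ_q, tᵢ + τ_q]` with datum `v_ℓ(tᵢ)` (time translation and restriction of
  Euler–Reynolds triples, `Torus.IsEulerReynoldsOn.timeTranslate`, `.restrict`);
* §3 supplies the stability bounds of this family and §4 the glued triple.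

Main statement: `BDSV.gluingStage_of_localEuler_of_stability_of_glued`.

## References

* T. Buckmaster, C. De Lellis, L. Székelyhidi Jr., V. Vicol, *Onsager's conjecture for admissible
  weak solutions*, Comm. Pure Appl. Math. 72 (2019) 229–274 = arXiv:1701.08678: §2.5 (CFL
  condition), §3.1 (3.1), Prop. 3.1, Cor. 3.2; §§3.2–3.3; §4.
-/

open MeasureTheory Set
open scoped NNReal ENNReal ContDiff Pointwise

noncomputable section

namespace Literature.Analysis.FluidPDE

/-! ## Time translation and restriction of Euler–Reynolds triples -/

namespace Torus

variable {d : Type*} [Fintype d] [DecidableEq d]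
variable {F : Type*} [NormedAddCommGroup F] [NormedSpace ℝ F]

omit [DecidableEq d] in
/-- `-a +ᵥ ((· - a)⁻¹' S) = S`. [folklore] -/
theorem neg_vadd_preimage_sub (a : ℝ) (S : Set ℝ) : -a +ᵥ ((fun t : ℝ => t - a) ⁻¹' S) = S := by
  ext t
  simp only [Set.mem_vadd_set, mem_preimage, vadd_eq_add]
  constructor
  · rintro ⟨y, hy, rfl⟩
    rw [neg_add_eq_sub]
    exact hy
  · intro ht
    exact ⟨t + a, by simpa using ht, by ring⟩

omit [Fintype d] [DecidableEq d] in
/-- The one-sided time derivative commutes with time translation: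
`∂ₜ[u(· - a)]` within `(· - a)⁻¹' S` at `t` is `∂ₜu` within `S` at `t - a`
(Mathlib `derivWithin_comp_sub_const`). [folklore] -/
theorem timeDerivWithin_comp_sub_right (S : Set ℝ) (w : ℝ → UnitAddTorus d → F) (a t : ℝ)
    (x : UnitAddTorus d) :
    FunctionSpaces.Torus.timeDerivWithin ((fun s : ℝ => s - a) ⁻¹' S) (fun s => w (s - a)) t x =
      FunctionSpaces.Torus.timeDerivWithin S w (t - a) x := by
  simp only [FunctionSpaces.Torus.timeDerivWithin]
  have h := derivWithin_comp_sub_const (fun σ => w σ x) a ((fun s : ℝ => s - a) ⁻¹' S) t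
  rw [neg_vadd_preimage_sub] at h
  exact h

omit [DecidableEq d] in
/-- Joint smoothness is invariant under time translation. [folklore] -/
theorem _root_.Literature.Analysis.FunctionSpaces.Torus.IsSmoothSpaceTimeOn.comp_sub_time
    {S : Set ℝ} {w : ℝ → UnitAddTorus d → F} (hw : FunctionSpaces.Torus.IsSmoothSpaceTimeOn S w)
    (a : ℝ) :
    FunctionSpaces.Torus.IsSmoothSpaceTimeOn ((fun s : ℝ => s - a) ⁻¹' S) (fun s => w (s - a)) := by
  have hφ : ContDiff ℝ ∞ (fun z : ℝ × EuclideanSpace ℝ d => ((z.1 - a, z.2) : ℝ × EuclideanSpace ℝ d)) :=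
    (contDiff_fst.sub contDiff_const).prodMk contDiff_snd
  have hmaps : MapsTo (fun z : ℝ × EuclideanSpace ℝ d => ((z.1 - a, z.2) : ℝ × EuclideanSpace ℝ d))
      (((fun s : ℝ => s - a) ⁻¹' S) ×ˢ univ) (S ×ˢ univ) := by
    rintro ⟨t, y⟩ hz
    exact mk_mem_prod (mem_prod.1 hz).1 (mem_univ _)
  exact hw.comp hφ.contDiffOn hmaps

variable {S S' : Set ℝ} {v : ℝ → UnitAddTorus d → EuclideanSpace ℝ d}
  {p : ℝ → UnitAddTorus d → ℝ} {R : ℝ → UnitAddTorus d → d → EuclideanSpace ℝ d}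

/-- **Time translation of Euler–Reynolds triples.** The system is autonomous: if `(v, p, R)`
solves Euler–Reynolds on `S × T^d` then `(v, p, R)(· - a)` solves it on `((· - a)⁻¹' S) × T^d`
(used in BDSV §3.1 to anchor the local solutions of Prop. 3.1 at `tᵢ`). [folklore] -/
theorem IsEulerReynoldsOn.timeTranslate (h : IsEulerReynoldsOn S v p R) (a : ℝ) :
    IsEulerReynoldsOn ((fun s : ℝ => s - a) ⁻¹' S) (fun t => v (t - a)) (fun t => p (t - a))
      (fun t => R (t - a)) where
  smooth_velocity := h.smooth_velocity.comp_sub_time a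
  smooth_pressure := h.smooth_pressure.comp_sub_time a
  smooth_stress := h.smooth_stress.comp_sub_time a
  momentum t ht x := by
    rw [timeDerivWithin_comp_sub_right]
    exact h.momentum (t - a) ht x
  divFree t ht := h.divFree (t - a) ht
  symm t ht := h.symm (t - a) ht
  traceFree t ht := h.traceFree (t - a) ht
  hasZeroMean_pressure t ht := h.hasZeroMean_pressure (t - a) ht

/-- **Restriction of Euler–Reynolds triples** to a smaller time set of unique differentiability
(the one-sided time derivatives within `S'` and within `S ⊇ S'` agree on `S'`). [folklore] -/
theorem IsEulerReynoldsOn.restrict (h : IsEulerReynoldsOn S v p R) (hS : S' ⊆ S)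
    (hU : UniqueDiffOn ℝ S') : IsEulerReynoldsOn S' v p R where
  smooth_velocity := h.smooth_velocity.mono hS
  smooth_pressure := h.smooth_pressure.mono hS
  smooth_stress := h.smooth_stress.mono hS
  momentum t ht x := by
    have h1 : FunctionSpaces.Torus.timeDerivWithin S' v t x = FunctionSpaces.Torus.timeDerivWithin S v t x := by
      have hd : HasDerivWithinAt (fun τ => v τ x) (FunctionSpaces.Torus.timeDerivWithin S v t x) S' t :=
        (h.smooth_velocity.hasDerivWithinAt_slice (hS ht) x).mono hS
      exact hd.derivWithin (hU t ht)
    rw [h1]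
    exact h.momentum t (hS ht) x
  divFree t ht := h.divFree t (hS ht)
  symm t ht := h.symm t (hS ht)
  traceFree t ht := h.traceFree t (hS ht)
  hasZeroMean_pressure t ht := h.hasZeroMean_pressure t (hS ht)

end Torus

namespace BDSV

/-! ## The life spans `Sᵢ` -/

section Intervals

/-- `Sᵢ = [max(iτ - τ, 0), min(iτ + τ, T)]`. [folklore] -/
theorem glueInterval_eq_Icc (T τ : ℝ) (i : ℕ) :
    glueInterval T τ i = Icc (max ((i : ℝ) * τ - τ) 0) (min ((i : ℝ) * τ + τ) T) := by
  rw [glueInterval, Icc_inter_Icc]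

/-- `Sᵢ` is a nondegenerate interval, hence a set of unique differentiability, when `0 < τ`,
`0 < T` and `tᵢ = iτ ≤ T`. [folklore] -/
theorem uniqueDiffOn_glueInterval {T τ : ℝ} (hT : 0 < T) (hτ : 0 < τ) {i : ℕ}
    (hi : (i : ℝ) * τ ≤ T) : UniqueDiffOn ℝ (glueInterval T τ i) := by
  rw [glueInterval_eq_Icc]
  refine uniqueDiffOn_Icc ?_
  have h0 : (0 : ℝ) ≤ (i : ℝ) * τ := by positivity
  rcases le_total ((i : ℝ) * τ - τ) 0 with h1 | h1 <;> rcases le_total ((i : ℝ) * τ + τ) T with h2 | h2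
  · rw [max_eq_right h1, min_eq_left h2]; linarith
  · rw [max_eq_right h1, min_eq_right h2]; exact hT
  · rw [max_eq_left h1, min_eq_left h2]; linarith
  · rw [max_eq_left h1, min_eq_right h2]; linarith

/-- `Sᵢ` lies in the translate `[tᵢ - τ, tᵢ + τ] = (· - tᵢ)⁻¹' [-τ, τ]` of the life span of
Prop. 3.1. [folklore] -/
theorem glueInterval_subset_preimage (T τ : ℝ) (i : ℕ) :
    glueInterval T τ i ⊆ (fun s : ℝ => s - (i : ℝ) * τ) ⁻¹' Icc (-τ) τ := by
  intro t ht
  simp only [mem_preimage, mem_Icc]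
  have h := ht.1
  rw [mem_Icc] at h
  constructor <;> linarith [h.1, h.2]

end Intervals

/-! ## The CFL bound on `‖v_ℓ‖_{1+α}` -/

section CFL

variable {β α a b T : ℝ} {q : ℕ} {Cin : ℕ → ℝ} {vℓ : ℝ → UnitAddTorus (Fin 3) → EuclideanSpace ℝ (Fin 3)}

/-- A `C^{k,r}` bound controls the derivatives pointwise: if `‖g‖_{k+r} ≤ B` then
`‖Dʲ(lift g)(y)‖ ≤ max B 0` for `j ≤ k`. [folklore] -/
theorem norm_iteratedFDeriv_lift_le_of_eContDiffHolderNorm_le {F : Type*} [NormedAddCommGroup F]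
    [NormedSpace ℝ F] {g : UnitAddTorus (Fin 3) → F} {k : ℕ} {r : ℝ≥0} {B : ℝ}
    (h : FunctionSpaces.Torus.eContDiffHolderNorm k r g ≤ ENNReal.ofReal B) {j : ℕ} (hj : j ≤ k)
    (y : EuclideanSpace ℝ (Fin 3)) :
    ‖iteratedFDeriv ℝ j (FunctionSpaces.Torus.lift g) y‖ ≤ max B 0 := by
  have h1 : ‖iteratedFDeriv ℝ j (FunctionSpaces.Torus.lift g) y‖ₑ ≤ ENNReal.ofReal B := by
    refine le_trans ?_ h
    unfold FunctionSpaces.Torus.eContDiffHolderNorm FunctionSpaces.eContDiffHolderNorm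
    refine le_trans ?_ le_self_add
    refine le_trans (FunctionSpaces.enorm_le_eSupNorm _ y) ?_
    exact Finset.single_le_sum (f := fun i => FunctionSpaces.eSupNorm (iteratedFDeriv ℝ i (FunctionSpaces.Torus.lift g)))
      (fun _ _ => bot_le) (Finset.mem_range.2 (Nat.lt_succ_of_le hj))
  have h2 : ENNReal.ofReal B = ENNReal.ofReal (max B 0) := by
    rcases le_total B 0 with hB | hB
    · rw [max_eq_right hB, ENNReal.ofReal_of_nonpos hB, ENNReal.ofReal_zero]
    · rw [max_eq_left hB]
  rw [h2, ← ofReal_norm] at h1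
  exact (ENNReal.ofReal_le_ofReal_iff (le_max_right _ _)).1 h1

/-- **The `C^{1,α}` norm of `v_ℓ` by interpolation of (2.13).** If `‖v_ℓ‖_{N+1} ≤ C_N δ_q^{1/2} λ_q ℓ^{-N}`
for `N = 0, 1` (2.13), then for `0 < α < 1` and `0 < ℓ ≤ 1`,
`‖v_ℓ(t)‖_{1+α} ≤ (4|C₀| + |C₁|) δ_q^{1/2} λ_q ℓ^{-α}` on `[0,T]`
(BDSV §2.5, the CFL display: "`τ_q ‖v_ℓ‖_{1+α} ≲ τ_q δ_q^{1/2} λ_q ℓ^{-α}`" by (2.13); here by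
`[Dv]_α ≤ ‖D²v‖_∞ ℓ^{1-α} + 2‖Dv‖_∞ ℓ^{-α}`). [cite: BuckmasterEtAl2018, §2.5 (CFL condition)] -/
theorem eContDiffHolderNorm_one_le_of_holderSupLE (hα : 0 < α) (hα1 : α < 1)
    (hℓ : 0 < mollScale β α a b q) (hℓ1 : mollScale β α a b q ≤ 1)
    (hA' : 0 ≤ Real.sqrt (amp β a b q) * freq a b q)
    (hsm : ∀ t ∈ Icc 0 T, FunctionSpaces.Torus.IsSmooth (vℓ t))
    (h213 : ∀ N : ℕ, HolderSupLE T vℓ (N + 1) 0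
      (Cin N * (Real.sqrt (amp β a b q) * freq a b q * mollScale β α a b q ^ (-(N : ℝ)))))
    {t : ℝ} (ht : t ∈ Icc 0 T) :
    FunctionSpaces.Torus.eContDiffHolderNorm 1 (Real.toNNReal α) (vℓ t) ≤
      ENNReal.ofReal ((4 * |Cin 0| + |Cin 1|) *
        (Real.sqrt (amp β a b q) * freq a b q * mollScale β α a b q ^ (-α))) := by
  set ℓ := mollScale β α a b q with hℓdef
  set A := Real.sqrt (amp β a b q) * freq a b q with hA
  -- the two instances of (2.13)
  have h0 := h213 0 t ht
  have h1 := h213 1 t ht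
  simp only [Nat.cast_zero, neg_zero, Real.rpow_zero, mul_one, zero_add] at h0
  simp only [Nat.cast_one] at h1
  set B₀ := Cin 0 * A with hB₀
  set B₁ := Cin 1 * (A * ℓ ^ (-(1 : ℝ))) with hB₁
  -- pointwise derivative bounds
  set M : ℕ → ℝ := fun i => if i ≤ 1 then max B₀ 0 else max B₁ 0 with hM
  have hM0 : ∀ i, 0 ≤ M i := fun i => by
    simp only [hM]; split_ifs <;> exact le_max_right _ _
  have hg : ContDiff ℝ 2 (FunctionSpaces.Torus.lift (vℓ t)) :=
    (hsm t ht).isContDiff (n := 2) (WithTop.coe_le_coe.mpr le_top)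
  have hMb : ∀ i ≤ 1 + 1, ∀ y : EuclideanSpace ℝ (Fin 3),
      ‖iteratedFDeriv ℝ i (FunctionSpaces.Torus.lift (vℓ t)) y‖ ≤ M i := by
    intro i hi y
    rcases Nat.lt_or_ge i 2 with hi2 | hi2
    · have hi1 : i ≤ 1 := by omega
      simp only [hM, if_pos hi1]
      exact norm_iteratedFDeriv_lift_le_of_eContDiffHolderNorm_le h0 hi1 y
    · have hi2' : i = 2 := by omega
      subst hi2'
      simp only [hM, show ¬ (2 ≤ 1) from by omega, if_false]
      exact norm_iteratedFDeriv_lift_le_of_eContDiffHolderNorm_le h1 le_rfl y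
  have hr : Real.toNNReal α ≤ 1 := by
    rw [← NNReal.coe_le_coe, Real.coe_toNNReal α hα.le, NNReal.coe_one]; exact hα1.le
  have key := FunctionSpaces.eContDiffHolderNorm_le_of_norm_iteratedFDeriv_le (k := 1) hg hM0 hMb hr hℓ
  -- `key : ‖lift (vℓ t)‖_{1+α} ≤ M 0 + M 1 + (M 2 ℓ^{1-α} + 2 M 1 ℓ⁻¹^α)`
  refine le_trans key (ENNReal.ofReal_le_ofReal ?_)
  have hαc : ((Real.toNNReal α : ℝ≥0) : ℝ) = α := Real.coe_toNNReal α hα.le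
  have hsum : (∑ i ∈ Finset.range (1 + 1), M i) = max B₀ 0 + max B₀ 0 := by
    simp [hM, Finset.sum_range_succ]
  have hM1 : M 1 = max B₀ 0 := by simp [hM]
  have hM2 : M (1 + 1) = max B₁ 0 := by simp [hM]
  rw [hαc, hsum, hM1, hM2]
  -- bounds on the maxima
  have hA0 : 0 ≤ A := hA'
  have hmax0 : max B₀ 0 ≤ |Cin 0| * A := by
    refine max_le ?_ (by positivity)
    calc B₀ = Cin 0 * A := rfl
      _ ≤ |Cin 0| * A := mul_le_mul_of_nonneg_right (le_abs_self _) hA0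
  have hℓm1 : 0 ≤ ℓ ^ (-(1 : ℝ)) := Real.rpow_nonneg hℓ.le _
  have hmax1 : max B₁ 0 ≤ |Cin 1| * (A * ℓ ^ (-(1 : ℝ))) := by
    refine max_le ?_ (by positivity)
    exact mul_le_mul_of_nonneg_right (le_abs_self _) (mul_nonneg hA0 hℓm1)
  -- powers of `ℓ`
  have hℓα : 1 ≤ ℓ ^ (-α) := Real.one_le_rpow_of_pos_of_le_one_of_nonpos hℓ hℓ1 (by linarith)
  have hℓcomb : ℓ ^ (-(1 : ℝ)) * ℓ ^ (1 - α) = ℓ ^ (-α) := by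
    rw [← Real.rpow_add hℓ]; congr 1; ring
  have hℓinv : ℓ⁻¹ ^ α = ℓ ^ (-α) := by
    rw [Real.inv_rpow hℓ.le, Real.rpow_neg hℓ.le]
  have hℓ1α : 0 ≤ ℓ ^ (1 - α) := Real.rpow_nonneg hℓ.le _
  have hℓα0 : 0 ≤ ℓ ^ (-α) := Real.rpow_nonneg hℓ.le _
  rw [hℓinv]
  -- assemble
  have e1 : max B₀ 0 + max B₀ 0 ≤ 2 * |Cin 0| * A * ℓ ^ (-α) := by
    have : 2 * |Cin 0| * A ≤ 2 * |Cin 0| * A * ℓ ^ (-α) :=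
      le_mul_of_one_le_right (by positivity) hℓα
    linarith
  have e2 : max B₁ 0 * ℓ ^ (1 - α) ≤ |Cin 1| * A * ℓ ^ (-α) := by
    calc max B₁ 0 * ℓ ^ (1 - α) ≤ |Cin 1| * (A * ℓ ^ (-(1 : ℝ))) * ℓ ^ (1 - α) :=
          mul_le_mul_of_nonneg_right hmax1 hℓ1α
      _ = |Cin 1| * A * (ℓ ^ (-(1 : ℝ)) * ℓ ^ (1 - α)) := by ring
      _ = |Cin 1| * A * ℓ ^ (-α) := by rw [hℓcomb]
  have e3 : 2 * max B₀ 0 * ℓ ^ (-α) ≤ 2 * |Cin 0| * A * ℓ ^ (-α) := by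
    have := mul_le_mul_of_nonneg_right hmax0 hℓα0
    nlinarith
  calc max B₀ 0 + max B₀ 0 + (max B₁ 0 * ℓ ^ (1 - α) + 2 * max B₀ 0 * ℓ ^ (-α))
      ≤ 2 * |Cin 0| * A * ℓ ^ (-α) + (|Cin 1| * A * ℓ ^ (-α) + 2 * |Cin 0| * A * ℓ ^ (-α)) :=
        add_le_add e1 (add_le_add e2 e3)
    _ = (4 * |Cin 0| + |Cin 1|) * (A * ℓ ^ (-α)) := by ring

/-- `τ_q · (K₀ δ_q^{1/2} λ_q ℓ^{-α}) = K₀ ℓ^α` (since `τ_q δ_q^{1/2} λ_q = ℓ^{2α}`, (2.16)). [folklore] -/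
theorem glueScale_mul_cflBound (ha : 1 ≤ a) (q : ℕ) (K₀ : ℝ) :
    glueScale β α a b q * (K₀ * (Real.sqrt (amp β a b q) * freq a b q * mollScale β α a b q ^ (-α))) =
      K₀ * mollScale β α a b q ^ α := by
  have hℓ := mollScale_pos (β := β) (α := α) (b := b) ha q
  have hA : 0 < Real.sqrt (amp β a b q) * freq a b q :=
    mul_pos (Real.sqrt_pos.2 (amp_pos ha q)) (freq_pos ha q)
  unfold glueScale
  rw [div_mul_eq_mul_div, div_eq_iff hA.ne']
  have h2 : mollScale β α a b q ^ (2 * α) * mollScale β α a b q ^ (-α) = mollScale β α a b q ^ α := by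
    rw [← Real.rpow_add hℓ]; congr 1; ring
  calc mollScale β α a b q ^ (2 * α) * (K₀ * (Real.sqrt (amp β a b q) * freq a b q * mollScale β α a b q ^ (-α)))
      = K₀ * (mollScale β α a b q ^ (2 * α) * mollScale β α a b q ^ (-α)) * (Real.sqrt (amp β a b q) * freq a b q) := by ring
    _ = K₀ * mollScale β α a b q ^ α * (Real.sqrt (amp β a b q) * freq a b q) := by rw [h2]

end CFL

/-! ## The assembly -/

section Assembly

/-- **The gluing stage from Prop. 3.1, §3 and §4.** `BDSV.localEulerHolder` (Prop. 3.1),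
`BDSV.gluingStability` (Cor. 3.2, Props. 3.3–3.4) and `BDSV.gluedTripleEstimates` (§4,
Props. 4.1–4.4) imply `BDSV.gluingStage` (§2.5, (2.17)–(2.22)). Proof = §3.1: given
`(v_ℓ, p_ℓ, R̊_ℓ)` with (2.13)–(2.14), the CFL condition `τ_q ‖v_ℓ(tᵢ)‖_{1+α} ≤ c(α)` holds for
`a` large (interpolation of (2.13), `ℓ^α ≤ λ_q^{-α} → 0`), so Prop. 3.1 yields exact solutions
`vᵢ` on `[tᵢ - τ_q, tᵢ + τ_q] ∩ [0,T]` with `vᵢ(tᵢ) = v_ℓ(tᵢ)`; §3 bounds them and §4 glues them.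
The thresholds are `α₀ = min(1, α₀^{§3}, α₀^{§4})`, `a₀ = max(a₀^{§3}, a₀^{§4}, a₀^{CFL})`, and the
output constant is that of §4. [cite: BuckmasterEtAl2018, §2.5 and §3.1] -/
theorem gluingStage_of_localEuler_of_stability_of_glued (h31 : localEulerHolder)
    (h3 : gluingStability) (h4 : gluedTripleEstimates) : gluingStage := by
  intro _ _ β hβ hβ3 b hb hb'
  obtain ⟨α₃, hα₃, h3⟩ := h3 β hβ hβ3 b hb hb'
  obtain ⟨α₄, hα₄, h4⟩ := h4 β hβ hβ3 b hb hb'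
  refine ⟨min 1 (min α₃ α₄), lt_min one_pos (lt_min hα₃ hα₄), fun α hα hαlt Nbar Cin => ?_⟩
  have hα1 : α < 1 := lt_of_lt_of_le hαlt (min_le_left _ _)
  have hα3' : α < α₃ := lt_of_lt_of_le hαlt ((min_le_right _ _).trans (min_le_left _ _))
  have hα4' : α < α₄ := lt_of_lt_of_le hαlt ((min_le_right _ _).trans (min_le_right _ _))
  obtain ⟨c, hc, Cloc, h31⟩ := h31 α hα hα1
  obtain ⟨C₃, a₃, ha₃, h3⟩ := h3 α hα hα3' (Nbar + 2) Cin
  obtain ⟨C₄, a₄, ha₄, h4⟩ := h4 α hα hα4' Nbar Cin C₃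
  set K₀ : ℝ := 4 * |Cin 0| + |Cin 1| with hK₀
  have hK₀ : 0 ≤ K₀ := by positivity
  obtain ⟨a₅, ha₅, h5⟩ := exists_threshold_rpow_neg (b := b) hb.le hα hc K₀
  refine ⟨C₄, max a₃ (max a₄ a₅), lt_max_of_lt_left ha₃, fun a ha T hT q vℓ pℓ Rℓ hER h213 h214 => ?_⟩
  have ha3 : a₃ ≤ a := (le_max_left _ _).trans ha
  have ha4 : a₄ ≤ a := ((le_max_left _ _).trans (le_max_right _ _)).trans ha
  have ha5 : a₅ ≤ a := ((le_max_right _ _).trans (le_max_right _ _)).trans ha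
  have ha1 : 1 ≤ a := ha₃.le.trans ha3
  -- abbreviations
  set τ := glueScale β α a b q with hτdef
  set ℓ := mollScale β α a b q with hℓdef
  have hτ : 0 < τ := glueScale_pos ha1 q
  have hℓ : 0 < ℓ := mollScale_pos ha1 q
  have hℓ1 : ℓ ≤ 1 := by
    calc ℓ ≤ (freq a b q)⁻¹ := mollScale_le_freq_inv ha1 hb.le hβ.le hα.le q
      _ ≤ 1 := inv_le_one_of_one_le₀ (one_le_freq ha1 q)
  have hA : 0 ≤ Real.sqrt (amp β a b q) * freq a b q :=
    mul_nonneg (Real.sqrt_nonneg _) (freq_pos ha1 q).le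
  -- the CFL constant `K = K₀ δ_q^{1/2} λ_q ℓ^{-α}` and `τ K ≤ c`
  set K : ℝ := K₀ * (Real.sqrt (amp β a b q) * freq a b q * ℓ ^ (-α)) with hKdef
  have hK0 : 0 ≤ K := mul_nonneg hK₀ (mul_nonneg hA (Real.rpow_nonneg hℓ.le _))
  have hτK : τ * K ≤ c := by
    rw [hKdef, hτdef, hℓdef, glueScale_mul_cflBound ha1 q K₀]
    calc K₀ * mollScale β α a b q ^ α ≤ K₀ * freq a b q ^ (-α) :=
          mul_le_mul_of_nonneg_left (mollScale_rpow_le ha1 hb.le hβ.le hα.le q) hK₀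
      _ ≤ c / 16 := h5 a ha5 q
      _ ≤ c := by linarith
  have hsm : ∀ t ∈ Icc 0 T, FunctionSpaces.Torus.IsSmooth (vℓ t) := fun t ht =>
    hER.smooth_velocity.isSmooth_slice ht
  -- Step 1 (§3.1): the exact solutions `vᵢ` anchored at `tᵢ = iτ ≤ T`
  have hfam : ∀ i : ℕ, ∃ (w : ℝ → UnitAddTorus (Fin 3) → EuclideanSpace ℝ (Fin 3)) (π : ℝ → UnitAddTorus (Fin 3) → ℝ),
      (i : ℝ) * τ ≤ T →
      IsExactEulerOn (glueInterval T τ i) w π ∧ w ((i : ℝ) * τ) = vℓ ((i : ℝ) * τ) := by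
    intro i
    by_cases hi : (i : ℝ) * τ ≤ T
    · have ht₀ : (i : ℝ) * τ ∈ Icc 0 T := ⟨by positivity, hi⟩
      have hKt : FunctionSpaces.Torus.eContDiffHolderNorm 1 (Real.toNNReal α) (vℓ ((i : ℝ) * τ)) ≤
          ENNReal.ofReal K :=
        eContDiffHolderNorm_one_le_of_holderSupLE hα hα1 hℓ hℓ1 hA hsm h213 ht₀
      obtain ⟨u, pu, hu, hu0, -, -⟩ := h31 (vℓ ((i : ℝ) * τ)) (hsm _ ht₀) (hER.divFree _ ht₀) K hK0 hKt
        τ hτ hτK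
      refine ⟨fun t => u (t - (i : ℝ) * τ), fun t => pu (t - (i : ℝ) * τ), fun _ => ⟨?_, ?_⟩⟩
      · exact (hu.timeTranslate ((i : ℝ) * τ)).restrict (glueInterval_subset_preimage T τ i)
          (uniqueDiffOn_glueInterval hT hτ hi)
      · simp [hu0]
    · exact ⟨fun _ _ => 0, fun _ _ => 0, fun h => absurd h hi⟩
  choose v p hvp using hfam
  -- Step 2 (§3): stability bounds of the family
  obtain ⟨h3i, h3ii⟩ := h3 a ha3 T hT q vℓ pℓ Rℓ hER h213 h214
  have hSB : ∀ i : ℕ, (i : ℝ) * τ ≤ T →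
      IsExactEulerOn (glueInterval T τ i) (v i) (p i) ∧ v i ((i : ℝ) * τ) = vℓ ((i : ℝ) * τ) ∧
      StabilityBounds β α a b T C₃ q (Nbar + 2) i vℓ pℓ (v i) (p i) :=
    fun i hi => ⟨(hvp i hi).1, (hvp i hi).2, h3i i (v i) (p i) hi (hvp i hi).1 (hvp i hi).2⟩
  have hPB : ∀ i : ℕ, ((i + 1 : ℕ) : ℝ) * τ ≤ T →
      PotentialBounds β α a b T C₃ q (Nbar + 2) i vℓ (v i) (v (i + 1)) := by
    intro i hi
    have hi' : (i : ℝ) * τ ≤ T := by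
      refine le_trans ?_ hi
      push_cast
      nlinarith [hτ.le]
    exact h3ii i (v i) (p i) (v (i + 1)) (p (i + 1)) hi (hvp i hi').1 (hvp i hi').2
      (hvp (i + 1) hi).1 (hvp (i + 1) hi).2
  -- Step 3 (§4): glue
  exact h4 a ha4 T hT q vℓ pℓ Rℓ hER h213 h214 v p hSB hPB

end Assembly

end BDSV

end Literature.Analysis.FluidPDE
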